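import Mathlib
import Summits.KontsevichZagierPeriods.Zeta5Search.Brown8.RecordQRateLimit
import Literature.NumberTheory.Irrationality.BrownZudilin2022.GeneralFamily
import HarnessLib

/-!
# ζ(5) search — supermultiplicativity of Brown–Zudilin's `Q` along an ARBITRARY ray (fam-brown8 g8, part A)

HONEST FRAMING: systematic search; no irrationality claim unless certified. Sizes of the integers `Q` of
[Brown–Zudilin 2022, (17)] (arXiv:2210.03391) along rays of the general family; nothing here bears on `ζ(5)`.

OUR work (Summit side). `Brown8/RecordQRateLimit` proved the existence of `lim log|Q(a·n)|/n` on the RECORD ray by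
supermultiplicativity of the summands of (17) (`qTerm_mul_le_add`, stated there for all parameters) + Fekete. The same
argument works on EVERY ray `n ↦ (n·p, n·q)` of (17). This part:
* `absQ_mul_le` — `|Q(n·p;n·q)|·|Q(m·p;m·q)| ≤ (n·q₁+1)(n·q₄+1)·|Q((n+m)·p;(n+m)·q)|` (`q₁ = q 0`, `q₄ = q 3` ≥ 0: the box of
  (17) is `[p₁, p₁+q₁] × [p₄, p₄+q₄]`);
* `absQ_pos` — if `Q(p;q) ≠ 0` then `Q(n·p;n·q) ≠ 0` for every `n ≥ 1`;
* `log_absQ_le` — a crude linear upper bound `log|Q(n·p;n·q)| ≤ K(p,q)·n` (`C(N,K) ≤ e^{|N|}`, number of terms).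
Part B (`Brown8/RayQRateLimit`): Fekete ⇒ the limit exists on every ray.
-/

noncomputable section

open Finset Real Filter Topology

namespace Summit.KontsevichZagierPeriods.Zeta5Search.Brown8

open Summit.KontsevichZagierPeriods.Zeta5Search.BinomialSum
open Literature.NumberTheory.Irrationality.BrownZudilin2022 (zchoose Qcoeff QOf pOf qOf Converges converges_iff_hForm
  hForm hList Fset)

/-! ### Rays of parameters -/

/-- The `n`-th point `n·p` of the ray through an integer vector `p`. -/
def ray {ι : Type*} (p : ι → ℤ) (n : ℕ) : ι → ℤ := fun i => (n : ℤ) * p i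

/-- `ray p n i = n·p i`. -/
@[simp] theorem ray_apply {ι : Type*} (p : ι → ℤ) (n : ℕ) (i : ι) : ray p n i = (n : ℤ) * p i := rfl

/-- Rays are additive in `n`. -/
theorem ray_add {ι : Type*} (p : ι → ℤ) (n m : ℕ) : ray p (n + m) = ray p n + ray p m := by
  ext i; simp [ray]; ring

/-- `ray p 1 = p`. -/
@[simp] theorem ray_one {ι : Type*} (p : ι → ℤ) : ray p 1 = p := by
  ext i; simp [ray]

/-- `|Q(n·p; n·q)|` as a real number. -/
def absQ (p : Fin 7 → ℤ) (q : Fin 5 → ℤ) (n : ℕ) : ℝ := |(Qcoeff (ray p n) (ray q n) : ℝ)|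

/-- `absQ ≥ 0`. -/
theorem absQ_nonneg (p : Fin 7 → ℤ) (q : Fin 5 → ℤ) (n : ℕ) : 0 ≤ absQ p q n := abs_nonneg _

/-- `|Q(n·p;n·q)|` as the box sum of its non-negative summands. -/
theorem absQ_eq_sum (p : Fin 7 → ℤ) (q : Fin 5 → ℤ) (n : ℕ) :
    absQ p q n = ∑ k₁ ∈ Icc ((n : ℤ) * p 1) ((n : ℤ) * p 1 + (n : ℤ) * q 0),
      ∑ k₂ ∈ Icc ((n : ℤ) * p 4) ((n : ℤ) * p 4 + (n : ℤ) * q 3), (qTerm (ray p n) (ray q n) k₁ k₂ : ℝ) := by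
  rw [absQ, abs_Qcoeff_eq_sum]; rfl

/-! ### Supermultiplicativity of the box sums -/

/-- Supermultiplicativity of the summands along the ray (real form). -/
theorem qTerm_rayGen_mul_le (p : Fin 7 → ℤ) (q : Fin 5 → ℤ) (n m : ℕ) (k₁ k₂ j₁ j₂ : ℤ) :
    (qTerm (ray p n) (ray q n) k₁ k₂ : ℝ) * (qTerm (ray p m) (ray q m) j₁ j₂ : ℝ)
      ≤ (qTerm (ray p (n + m)) (ray q (n + m)) (k₁ + j₁) (k₂ + j₂) : ℝ) := by
  rw [ray_add, ray_add]
  exact_mod_cast qTerm_mul_le_add (ray p n) (ray p m) (ray q n) (ray q m) k₁ k₂ j₁ j₂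

/-- Shifting a sum over an integer interval. -/
private theorem sum_Icc_shift' (f : ℤ → ℝ) (a b c : ℤ) :
    ∑ j ∈ Icc a b, f (c + j) = ∑ i ∈ Icc (c + a) (c + b), f i := by
  rw [← Finset.map_add_left_Icc, Finset.sum_map]; rfl

/-- For a fixed summand index `(k₁,k₂)` of the `n`-box: `t_n(k₁,k₂)·|Q_m| ≤ |Q_{n+m}|`. -/
theorem qTerm_mul_absQ_le (p : Fin 7 → ℤ) (q : Fin 5 → ℤ) {n : ℕ} (m : ℕ) {k₁ k₂ : ℤ}
    (hk₁ : k₁ ∈ Icc ((n : ℤ) * p 1) ((n : ℤ) * p 1 + (n : ℤ) * q 0))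
    (hk₂ : k₂ ∈ Icc ((n : ℤ) * p 4) ((n : ℤ) * p 4 + (n : ℤ) * q 3)) :
    (qTerm (ray p n) (ray q n) k₁ k₂ : ℝ) * absQ p q m ≤ absQ p q (n + m) := by
  rw [mem_Icc] at hk₁ hk₂
  rw [absQ_eq_sum p q m, absQ_eq_sum p q (n + m), Finset.mul_sum]
  have hnn : ∀ i₁ i₂ : ℤ, (0 : ℝ) ≤ (qTerm (ray p (n + m)) (ray q (n + m)) i₁ i₂ : ℝ) := fun i₁ i₂ => by
    exact_mod_cast qTerm_nonneg _ _ _ _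
  calc ∑ j₁ ∈ Icc ((m : ℤ) * p 1) ((m : ℤ) * p 1 + (m : ℤ) * q 0), (qTerm (ray p n) (ray q n) k₁ k₂ : ℝ)
          * ∑ j₂ ∈ Icc ((m : ℤ) * p 4) ((m : ℤ) * p 4 + (m : ℤ) * q 3), (qTerm (ray p m) (ray q m) j₁ j₂ : ℝ)
      ≤ ∑ j₁ ∈ Icc ((m : ℤ) * p 1) ((m : ℤ) * p 1 + (m : ℤ) * q 0),
          ∑ j₂ ∈ Icc ((m : ℤ) * p 4) ((m : ℤ) * p 4 + (m : ℤ) * q 3),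
          (qTerm (ray p (n + m)) (ray q (n + m)) (k₁ + j₁) (k₂ + j₂) : ℝ) := by
        refine sum_le_sum fun j₁ _ => ?_
        rw [Finset.mul_sum]
        exact sum_le_sum fun j₂ _ => qTerm_rayGen_mul_le p q n m k₁ k₂ j₁ j₂
    _ = ∑ i₁ ∈ Icc (k₁ + (m : ℤ) * p 1) (k₁ + ((m : ℤ) * p 1 + (m : ℤ) * q 0)),
          ∑ i₂ ∈ Icc (k₂ + (m : ℤ) * p 4) (k₂ + ((m : ℤ) * p 4 + (m : ℤ) * q 3)),
          (qTerm (ray p (n + m)) (ray q (n + m)) i₁ i₂ : ℝ) := by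
        rw [← sum_Icc_shift' (fun i₁ => ∑ i₂ ∈ Icc (k₂ + (m : ℤ) * p 4) (k₂ + ((m : ℤ) * p 4 + (m : ℤ) * q 3)),
          (qTerm (ray p (n + m)) (ray q (n + m)) i₁ i₂ : ℝ))]
        refine sum_congr rfl fun j₁ _ => ?_
        rw [← sum_Icc_shift']
    _ ≤ ∑ i₁ ∈ Icc (k₁ + (m : ℤ) * p 1) (k₁ + ((m : ℤ) * p 1 + (m : ℤ) * q 0)),
          ∑ i₂ ∈ Icc (((n + m : ℕ) : ℤ) * p 4) (((n + m : ℕ) : ℤ) * p 4 + ((n + m : ℕ) : ℤ) * q 3),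
          (qTerm (ray p (n + m)) (ray q (n + m)) i₁ i₂ : ℝ) := by
        refine sum_le_sum fun i₁ _ => ?_
        refine sum_le_sum_of_subset_of_nonneg (Icc_subset_Icc ?_ ?_) fun i₂ _ _ => hnn i₁ i₂
        · push_cast; linarith [hk₂.1]
        · push_cast; linarith [hk₂.2]
    _ ≤ ∑ i₁ ∈ Icc (((n + m : ℕ) : ℤ) * p 1) (((n + m : ℕ) : ℤ) * p 1 + ((n + m : ℕ) : ℤ) * q 0),
          ∑ i₂ ∈ Icc (((n + m : ℕ) : ℤ) * p 4) (((n + m : ℕ) : ℤ) * p 4 + ((n + m : ℕ) : ℤ) * q 3),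
          (qTerm (ray p (n + m)) (ray q (n + m)) i₁ i₂ : ℝ) := by
        refine sum_le_sum_of_subset_of_nonneg (Icc_subset_Icc ?_ ?_) fun i₁ _ _ => sum_nonneg fun i₂ _ => hnn i₁ i₂
        · push_cast; linarith [hk₁.1]
        · push_cast; linarith [hk₁.2]

/-- **`|Q_n|·|Q_m| ≤ (n·q₁+1)(n·q₄+1)·|Q_{n+m}|`** (for `q₁, q₄ ≥ 0`: the number of summands of the `n`-box times the
supermultiplicativity of each summand). -/
theorem absQ_mul_le (p : Fin 7 → ℤ) (q : Fin 5 → ℤ) (hq0 : 0 ≤ q 0) (hq3 : 0 ≤ q 3) (n m : ℕ) :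
    absQ p q n * absQ p q m ≤ ((n : ℝ) * (q 0 : ℝ) + 1) * ((n : ℝ) * (q 3 : ℝ) + 1) * absQ p q (n + m) := by
  have hc1 : ((Icc ((n : ℤ) * p 1) ((n : ℤ) * p 1 + (n : ℤ) * q 0)).card : ℝ) = (n : ℝ) * (q 0 : ℝ) + 1 := by
    rw [Int.card_Icc, show (n : ℤ) * p 1 + (n : ℤ) * q 0 + 1 - (n : ℤ) * p 1 = (n : ℤ) * q 0 + 1 by ring]
    have h : ((((n : ℤ) * q 0 + 1).toNat : ℕ) : ℤ) = (n : ℤ) * q 0 + 1 := Int.toNat_of_nonneg (by positivity)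
    exact_mod_cast h
  have hc2 : ((Icc ((n : ℤ) * p 4) ((n : ℤ) * p 4 + (n : ℤ) * q 3)).card : ℝ) = (n : ℝ) * (q 3 : ℝ) + 1 := by
    rw [Int.card_Icc, show (n : ℤ) * p 4 + (n : ℤ) * q 3 + 1 - (n : ℤ) * p 4 = (n : ℤ) * q 3 + 1 by ring]
    have h : ((((n : ℤ) * q 3 + 1).toNat : ℕ) : ℤ) = (n : ℤ) * q 3 + 1 := Int.toNat_of_nonneg (by positivity)
    exact_mod_cast h
  calc absQ p q n * absQ p q m
      = ∑ k₁ ∈ Icc ((n : ℤ) * p 1) ((n : ℤ) * p 1 + (n : ℤ) * q 0),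
          ∑ k₂ ∈ Icc ((n : ℤ) * p 4) ((n : ℤ) * p 4 + (n : ℤ) * q 3),
          (qTerm (ray p n) (ray q n) k₁ k₂ : ℝ) * absQ p q m := by
        rw [absQ_eq_sum p q n, Finset.sum_mul]
        exact sum_congr rfl fun _ _ => Finset.sum_mul _ _ _
    _ ≤ ∑ _k₁ ∈ Icc ((n : ℤ) * p 1) ((n : ℤ) * p 1 + (n : ℤ) * q 0),
          ∑ _k₂ ∈ Icc ((n : ℤ) * p 4) ((n : ℤ) * p 4 + (n : ℤ) * q 3), absQ p q (n + m) :=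
        sum_le_sum fun k₁ hk₁ => sum_le_sum fun k₂ hk₂ => qTerm_mul_absQ_le p q m hk₁ hk₂
    _ = ((n : ℝ) * (q 0 : ℝ) + 1) * ((n : ℝ) * (q 3 : ℝ) + 1) * absQ p q (n + m) := by
        rw [sum_const, sum_const, nsmul_eq_mul, nsmul_eq_mul, hc1, hc2]; ring

/-- **Non-vanishing propagates along the ray**: if `Q(p;q) ≠ 0` then `|Q(n·p;n·q)| > 0` for all `n ≥ 1`. -/
theorem absQ_pos (p : Fin 7 → ℤ) (q : Fin 5 → ℤ) (hq0 : 0 ≤ q 0) (hq3 : 0 ≤ q 3) (hQ : Qcoeff p q ≠ 0) :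
    ∀ n : ℕ, 1 ≤ n → 0 < absQ p q n := by
  have h1 : 0 < absQ p q 1 := by
    rw [absQ, ray_one, ray_one]; exact abs_pos.mpr (by exact_mod_cast hQ)
  intro n hn
  induction n with
  | zero => omega
  | succ k ih =>
    rcases Nat.eq_zero_or_pos k with hk | hk
    · subst hk; exact h1
    have hk' := ih hk
    have hmul := absQ_mul_le p q hq0 hq3 1 k
    rw [show 1 + k = k + 1 by omega] at hmul
    have hpos : 0 < absQ p q 1 * absQ p q k := mul_pos h1 hk'
    have hT : (0 : ℝ) < ((1 : ℕ) : ℝ) * (q 0 : ℝ) + 1 := by push_cast; positivity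
    have hT' : (0 : ℝ) < ((1 : ℕ) : ℝ) * (q 3 : ℝ) + 1 := by push_cast; positivity
    by_contra hle
    have h0 : absQ p q (k + 1) = 0 := le_antisymm (not_lt.mp hle) (absQ_nonneg _ _ _)
    rw [h0, mul_zero] at hmul
    linarith

/-! ### A crude linear upper bound -/

/-- `C(N,K) ≤ e^{|N|}` for the integer binomial. -/
theorem zchoose_le_exp_abs (N K : ℤ) : (zchoose N K : ℝ) ≤ Real.exp |(N : ℝ)| := by
  by_cases h : 0 ≤ K ∧ K ≤ N
  · obtain ⟨n, hn⟩ := Int.eq_ofNat_of_zero_le (h.1.trans h.2)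
    obtain ⟨k, hk⟩ := Int.eq_ofNat_of_zero_le h.1
    subst hn hk
    rw [zchoose_cast_eq rfl rfl (by exact_mod_cast h.2)]
    push_cast
    rw [abs_of_nonneg (Nat.cast_nonneg n)]
    calc ((n.choose k : ℕ) : ℝ) ≤ ((2 ^ n : ℕ) : ℝ) := by exact_mod_cast Nat.choose_le_two_pow n k
      _ = (2 : ℝ) ^ n := by push_cast; ring
      _ ≤ (Real.exp 1) ^ n := by
          gcongr
          have := Real.add_one_le_exp (1 : ℝ); linarith
      _ = Real.exp (n : ℝ) := by rw [← Real.exp_nat_mul, mul_one]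
  · rw [show zchoose N K = 0 by unfold zchoose; rw [if_neg h]]
    push_cast; positivity

/-- The crude termwise bound: every summand of (17) is `≤ exp` of the sum of the absolute values of the upper arguments
of its seven binomials. -/
theorem qTerm_le_exp_abs (p : Fin 7 → ℤ) (q : Fin 5 → ℤ) (k₁ k₂ : ℤ) :
    (qTerm p q k₁ k₂ : ℝ) ≤ Real.exp (|(k₁ : ℝ)| + |(k₂ : ℝ)| + |((k₁ + k₂ + q 2 - p 0 - p 6 : ℤ) : ℝ)|
      + |(q 0 : ℝ)| + |(q 1 : ℝ)| + |(q 3 : ℝ)| + |(q 4 : ℝ)|) := by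
  unfold qTerm
  push_cast
  rw [Real.exp_add, Real.exp_add, Real.exp_add, Real.exp_add, Real.exp_add, Real.exp_add]
  have z : ∀ a b : ℤ, (0 : ℝ) ≤ (zchoose a b : ℝ) := fun a b => by exact_mod_cast zchoose_nonneg a b
  have e := zchoose_le_exp_abs
  have e3 := zchoose_le_exp_abs (k₁ + k₂ + q 2 - p 0 - p 6) (p 3 + q 2 - p 0 - p 6)
  push_cast at e3
  exact prod7_le (z _ _) (z _ _) (z _ _) (z _ _) (z _ _) (z _ _) (z _ _) (e _ _) (e _ _) e3 (e _ _) (e _ _) (e _ _) (e _ _)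

/-- The linear constant of the crude bound. -/
def crudeK (p : Fin 7 → ℤ) (q : Fin 5 → ℤ) : ℝ :=
  2 * (|(p 1 : ℝ)| + |(q 0 : ℝ)|) + 2 * (|(p 4 : ℝ)| + |(q 3 : ℝ)|) + |(q 2 : ℝ)| + |(p 0 : ℝ)| + |(p 6 : ℝ)|
    + |(q 0 : ℝ)| + |(q 1 : ℝ)| + |(q 3 : ℝ)| + |(q 4 : ℝ)| + |(q 0 : ℝ)| + |(q 3 : ℝ)|

/-- **Crude linear upper bound**: `log|Q(n·p;n·q)| ≤ K·n` for `n ≥ 1` (when `q₁, q₄ ≥ 0`). -/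
theorem log_absQ_le (p : Fin 7 → ℤ) (q : Fin 5 → ℤ) (hq0 : 0 ≤ q 0) (hq3 : 0 ≤ q 3) {n : ℕ} (hn : 1 ≤ n)
    (hpos : 0 < absQ p q n) : Real.log (absQ p q n) ≤ crudeK p q * n := by
  have hn' : (1 : ℝ) ≤ n := by exact_mod_cast hn
  have hq0' : (0 : ℝ) ≤ q 0 := by exact_mod_cast hq0
  have hq3' : (0 : ℝ) ≤ q 3 := by exact_mod_cast hq3
  -- the exponent bound on the box
  set B : ℝ := 2 * (|(p 1 : ℝ)| + |(q 0 : ℝ)|) + 2 * (|(p 4 : ℝ)| + |(q 3 : ℝ)|) + |(q 2 : ℝ)| + |(p 0 : ℝ)| + |(p 6 : ℝ)|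
    + |(q 0 : ℝ)| + |(q 1 : ℝ)| + |(q 3 : ℝ)| + |(q 4 : ℝ)| with hB
  have hterm : ∀ k₁ ∈ Icc ((n : ℤ) * p 1) ((n : ℤ) * p 1 + (n : ℤ) * q 0),
      ∀ k₂ ∈ Icc ((n : ℤ) * p 4) ((n : ℤ) * p 4 + (n : ℤ) * q 3),
      (qTerm (ray p n) (ray q n) k₁ k₂ : ℝ) ≤ Real.exp (B * n) := by
    intro k₁ hk₁ k₂ hk₂
    rw [mem_Icc] at hk₁ hk₂
    refine (qTerm_le_exp_abs (ray p n) (ray q n) k₁ k₂).trans (Real.exp_le_exp.mpr ?_)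
    simp only [ray_apply]
    push_cast
    have hn0 : (0 : ℝ) ≤ n := by linarith
    obtain ⟨a1, a2⟩ := hk₁
    obtain ⟨b1, b2⟩ := hk₂
    have a1' : ((n : ℤ) * p 1 : ℝ) ≤ k₁ := by exact_mod_cast a1
    have a2' : (k₁ : ℝ) ≤ (n : ℤ) * p 1 + (n : ℤ) * q 0 := by exact_mod_cast a2
    have b1' : ((n : ℤ) * p 4 : ℝ) ≤ k₂ := by exact_mod_cast b1
    have b2' : (k₂ : ℝ) ≤ (n : ℤ) * p 4 + (n : ℤ) * q 3 := by exact_mod_cast b2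
    push_cast at a1' a2' b1' b2'
    have hk1abs : |(k₁ : ℝ)| ≤ n * (|(p 1 : ℝ)| + |(q 0 : ℝ)|) := by
      rw [abs_le]; constructor
      · nlinarith [neg_abs_le (p 1 : ℝ), neg_abs_le (q 0 : ℝ), abs_nonneg (q 0 : ℝ)]
      · nlinarith [le_abs_self (p 1 : ℝ), le_abs_self (q 0 : ℝ)]
    have hk2abs : |(k₂ : ℝ)| ≤ n * (|(p 4 : ℝ)| + |(q 3 : ℝ)|) := by
      rw [abs_le]; constructor
      · nlinarith [neg_abs_le (p 4 : ℝ), neg_abs_le (q 3 : ℝ), abs_nonneg (q 3 : ℝ)]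
      · nlinarith [le_abs_self (p 4 : ℝ), le_abs_self (q 3 : ℝ)]
    have h3 : |(k₁ : ℝ) + k₂ + n * (q 2 : ℝ) - n * (p 0 : ℝ) - n * (p 6 : ℝ)|
        ≤ |(k₁ : ℝ)| + |(k₂ : ℝ)| + n * (|(q 2 : ℝ)| + |(p 0 : ℝ)| + |(p 6 : ℝ)|) := by
      have t1 := abs_add_le ((k₁ : ℝ) + k₂) (n * (q 2 : ℝ) - n * (p 0 : ℝ) - n * (p 6 : ℝ))
      have t2 := abs_add_le (k₁ : ℝ) (k₂ : ℝ)
      have t3 : |(n : ℝ) * (q 2 : ℝ) - n * (p 0 : ℝ) - n * (p 6 : ℝ)| ≤ n * (|(q 2 : ℝ)| + |(p 0 : ℝ)| + |(p 6 : ℝ)|) := by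
        rw [show (n : ℝ) * (q 2 : ℝ) - n * (p 0 : ℝ) - n * (p 6 : ℝ) = n * ((q 2 : ℝ) - p 0 - p 6) by ring, abs_mul,
          abs_of_nonneg hn0]
        gcongr
        calc |(q 2 : ℝ) - p 0 - p 6| ≤ |(q 2 : ℝ) - p 0| + |(p 6 : ℝ)| := abs_sub _ _
          _ ≤ |(q 2 : ℝ)| + |(p 0 : ℝ)| + |(p 6 : ℝ)| := by linarith [abs_sub (q 2 : ℝ) (p 0 : ℝ)]
      rw [show (k₁ : ℝ) + k₂ + n * (q 2 : ℝ) - n * (p 0 : ℝ) - n * (p 6 : ℝ)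
        = ((k₁ : ℝ) + k₂) + (n * (q 2 : ℝ) - n * (p 0 : ℝ) - n * (p 6 : ℝ)) by ring]
      linarith
    have h4 : ∀ x : ℤ, |((n : ℝ) * (x : ℝ))| = n * |(x : ℝ)| := fun x => by rw [abs_mul, abs_of_nonneg hn0]
    rw [h4, h4, h4, h4]
    rw [hB]
    nlinarith [abs_nonneg (p 1 : ℝ), abs_nonneg (q 0 : ℝ), abs_nonneg (p 4 : ℝ), abs_nonneg (q 3 : ℝ),
      abs_nonneg (q 2 : ℝ), abs_nonneg (p 0 : ℝ), abs_nonneg (p 6 : ℝ), abs_nonneg (q 1 : ℝ), abs_nonneg (q 4 : ℝ)]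
  -- number of terms
  have hQle := abs_Qcoeff_le_of_forall (ray p n) (ray q n) (by simp; positivity) (by simp; positivity) hterm
  simp only [ray_apply] at hQle
  push_cast at hQle
  have hQle' : absQ p q n ≤ ((n : ℝ) * (q 0 : ℝ) + 1) * ((n : ℝ) * (q 3 : ℝ) + 1) * Real.exp (B * n) := hQle
  have h := Real.log_le_log hpos hQle'
  rw [Real.log_mul (by positivity) (by positivity), Real.log_mul (by positivity) (by positivity), Real.log_exp] at h
  have l1 : Real.log ((n : ℝ) * (q 0 : ℝ) + 1) ≤ n * (q 0 : ℝ) := by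
    have := Real.log_le_sub_one_of_pos (show (0 : ℝ) < n * (q 0 : ℝ) + 1 by positivity); linarith
  have l2 : Real.log ((n : ℝ) * (q 3 : ℝ) + 1) ≤ n * (q 3 : ℝ) := by
    have := Real.log_le_sub_one_of_pos (show (0 : ℝ) < n * (q 3 : ℝ) + 1 by positivity); linarith
  have e0 : (q 0 : ℝ) ≤ |(q 0 : ℝ)| := le_abs_self _
  have e3 : (q 3 : ℝ) ≤ |(q 3 : ℝ)| := le_abs_self _
  unfold crudeK
  rw [← hB]
  nlinarith

end Summit.KontsevichZagierPeriods.Zeta5Search.Brown8
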